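import Mathlib.MeasureTheory.Function.L2Space
import Mathlib.MeasureTheory.Function.LpOrder
import Mathlib.Analysis.InnerProductSpace.Adjoint
import Mathlib.Analysis.Normed.Order.Lattice
import HarnessLib

/-!
# Positivity improving operators have a simple, strictly positive top eigenvector
# (Reed–Simon IV, §XIII.12, Theorems XIII.43–XIII.44) — PROVED

Topic `Literature/Analysis/OperatorTheory`; requested (`wi-09054`) by route `WeilGroundState` of
`RiemannHypothesis` (support item `MarkovPartPositiveGroundState` =
`stmt-RiemannHypothesis-1530`: "Beurling–Deny ⇒ positivity-preserving semigroup; … ⇒ positivity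
IMPROVING; compact resolvent ⇒ Reed–Simon XIII.44 / Jentzsch: the bottom of `Q₀` is a simple
eigenvalue with an a.e. strictly positive eigenfunction"), and reusable by any
Perron–Frobenius / ground-state argument in the tree.

**The printed results** (Reed–Simon IV, §XIII.12, pp. 201–204). Definitions (p. 201): on
`L²(M, dμ)`, `f` is *positive* if `f ≥ 0` a.e. and `f` is not the zero function, *strictly
positive* if `f > 0` a.e.; a bounded operator `A` is *positivity preserving* if `Af` is positive
whenever `f` is, *positivity improving* if `Af` is strictly positive whenever `f` is positive,
*ergodic* if it is positivity preserving and for all positive `u, v` some `(u, Aⁿv) ≠ 0`; every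
positivity improving map is ergodic. **Theorem XIII.43**: for a bounded positive operator `A` on
`L²(M, dμ)` which is positivity preserving and such that `‖A‖` is an eigenvalue, TFAE: (a) `‖A‖`
is a simple eigenvalue and the associated eigenvector is strictly positive; (b) `A` is ergodic;
(c) `L^∞(M) ∪ {A}` acts irreducibly. **Theorem XIII.44**: for `H` self-adjoint and bounded below
with `e^{-tH}` positivity preserving and `E = inf σ(H)` an eigenvalue, TFAE: (a) `E` is simple
with a strictly positive eigenvector; (b)/(d) `(H − λ)⁻¹` ergodic for some / positivity
improving for all `λ < E`; (c)/(e) `e^{-tH}` ergodic for some / positivity improving for all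
`t > 0` — proved by applying XIII.43 to `A = e^{-tH}` or `A = (H − λ)⁻¹`, whose top eigenspace
`‖A‖ = e^{-tE}`, resp. `(E − λ)⁻¹`, is the bottom eigenspace of `H`.

**What is here, all PROVED** (no named facts): the four definitions, rendered on the REAL Hilbert
space `Lp ℝ 2 μ` (Mathlib's `L²` with its a.e. order and lattice structure), and the implication
that applications use, *positivity improving ⇒ (a)*, in the sharp "absolute value" form of
Reed–Simon's proof of `(c) ⇒ (a)` (p. 202–203):

* `IsPositivityImproving.top_eigenvector_abs`: if `A` is self-adjoint and positivity improving and
  `Aψ = ‖A‖ψ` with `ψ ≠ 0`, then `|ψ|` is an a.e. strictly positive eigenvector, `ψ = |ψ|` or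
  `ψ = −|ψ|`, and EVERY eigenvector `η` (`Aη = ‖A‖η`) equals `(⟪|ψ|, η⟫/‖ψ‖²) |ψ|`;
* `IsPositivityImproving.simple_top_eigenvalue`: hence the `‖A‖`-eigenspace is spanned by a
  unit, a.e. strictly positive eigenvector `φ` (`η = ⟪φ, η⟫ φ` for every eigenvector `η`) —
  conclusion (a).

Ingredients, all proved here: `|Af| ≤ A|f|` a.e. (`abs_apply_le`); `⟪ψ, Aψ⟫ ≤ ⟪|ψ|, A|ψ|⟫`
(`inner_le_inner_abs`); the variational lemma `‖A‖‖f‖² ≤ ⟪f, Af⟫ ⇒ Af = ‖A‖f` for symmetric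
bounded `A` on any real inner product space (`apply_eq_norm_smul_of_le_inner`, replacing the
spectral-projection argument of the book); `(u, q) > 0` for `u` positive and `q` strictly positive
(`inner_pos`, the remark on p. 201); improving ⇒ preserving ⇒ ergodic bookkeeping.

## Rendering choices / scope

* Real scalars: the statements are on `Lp ℝ 2 μ`; Reed–Simon work on complex `L²` and finish by
  splitting an eigenvector into real and imaginary parts (p. 203, last paragraph of the proof) —
  that reduction is left to complex-valued consumers (a positivity preserving operator maps real
  functions to real functions).
* Hypotheses are WEAKER than printed where the proof allows: `A` self-adjoint (not necessarily
  `≥ 0`), positivity improving (which implies the preserving/ergodic hypotheses), no σ-finiteness.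
* Not here: the converse implications (a) ⇒ (b) ⇒ (c) of XIII.43, the semigroup/resolvent
  bookkeeping of XIII.44 (no unbounded `e^{-tH}` calculus in the tree: apply
  `simple_top_eigenvalue` to the bounded self-adjoint operator `A = e^{-tH}` or `(H − λ)⁻¹`, whose
  top eigenvectors are exactly the ground states of `H`), the perturbation theorems XIII.45–46.

## Mathlib / tree search

Mathlib (this pin): no `PositivityPreserving/Improving`, no Perron–Frobenius, Jentzsch or
Krein–Rutman theorem for operators (`lean search` "Perron", "KreinRutman", "positivity improving":
nothing); used: `MeasureTheory.Lp` lattice order (`LpOrder.lean`: `Lp.coeFn_le/nonneg/abs`,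
`HasSolidNorm` ⇒ `norm_abs_eq_norm`), `L2.inner_def`, `L2.integrable_inner`,
`integral_eq_zero_iff_of_nonneg_ae`, `ContinuousLinearMap.le_opNorm`, `real_inner_le_norm`,
`IsSelfAdjoint.isSymmetric`. Tree: nothing on positivity preserving operators
(`BoseEinsteinCondensation.lean` only mentions the phrase).

## References

* M. Reed, B. Simon, *Methods of Modern Mathematical Physics IV: Analysis of Operators*, Academic
  Press (1978), §XIII.12 "Nondegeneracy of the ground state", pp. 201–204: Definition (p. 201),
  Theorem XIII.43, Proposition, Theorem XIII.44. [`ReedSimonIV1978`]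
-/

noncomputable section

open MeasureTheory
open scoped RealInnerProductSpace ENNReal

namespace Literature.Analysis.OperatorTheory

variable {M : Type*} [MeasurableSpace M] {μ : Measure M}

/-! ### Definitions (Reed–Simon IV, p. 201) -/

/-- A function `f ∈ L²(M, dμ)` (real valued) is **positive** if `f ≥ 0` a.e. and `f` is not the
zero function (Reed–Simon IV, §XIII.12, Definition p. 201; the order on `Lp ℝ 2 μ` is the a.e.
order, `Lp.coeFn_nonneg`). [cite: ReedSimonIV1978, §XIII.12 Definition (p. 201)] -/
def IsPositiveFun (f : Lp ℝ 2 μ) : Prop := 0 ≤ f ∧ f ≠ 0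

/-- A function `f ∈ L²(M, dμ)` is **strictly positive** if `f > 0` a.e.
(Reed–Simon IV, §XIII.12, Definition p. 201).
[cite: ReedSimonIV1978, §XIII.12 Definition (p. 201)] -/
def IsStrictlyPositiveFun (f : Lp ℝ 2 μ) : Prop := ∀ᵐ x ∂μ, 0 < f x

/-- A bounded operator `A` on `L²(M, dμ)` is **positivity preserving** if `Af` is positive whenever
`f` is positive (Reed–Simon IV, §XIII.12, Definition p. 201 — note that this includes `Af ≠ 0`).
[cite: ReedSimonIV1978, §XIII.12 Definition (p. 201)] -/
def IsPositivityPreserving (A : Lp ℝ 2 μ →L[ℝ] Lp ℝ 2 μ) : Prop :=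
  ∀ f, IsPositiveFun f → IsPositiveFun (A f)

/-- A bounded operator `A` on `L²(M, dμ)` is **positivity improving** if `Af` is strictly positive
whenever `f` is positive (Reed–Simon IV, §XIII.12, Definition p. 201).
[cite: ReedSimonIV1978, §XIII.12 Definition (p. 201)] -/
def IsPositivityImproving (A : Lp ℝ 2 μ →L[ℝ] Lp ℝ 2 μ) : Prop :=
  ∀ f, IsPositiveFun f → IsStrictlyPositiveFun (A f)

/-- A bounded operator `A` on `L²(M, dμ)` is **ergodic** if it is positivity preserving and for any
positive `u, v` there is some `n > 0` with `(u, Aⁿv) ≠ 0` (Reed–Simon IV, §XIII.12, Definition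
p. 201). [cite: ReedSimonIV1978, §XIII.12 Definition (p. 201)] -/
def IsErgodicOp (A : Lp ℝ 2 μ →L[ℝ] Lp ℝ 2 μ) : Prop :=
  IsPositivityPreserving A ∧
    ∀ u v, IsPositiveFun u → IsPositiveFun v → ∃ n : ℕ, 0 < n ∧ ⟪u, (A ^ n) v⟫ ≠ 0

/-! ### `L²` bookkeeping -/

/-- The `L²` inner product of real functions is `∫ f g`. [folklore] -/
theorem inner_eq_integral (f g : Lp ℝ 2 μ) : ⟪f, g⟫ = ∫ x, f x * g x ∂μ := by
  rw [L2.inner_def]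
  simp only [RCLike.inner_apply, conj_trivial, mul_comm]

/-- The product of two real `L²` functions is integrable (Hölder). [folklore] -/
theorem integrable_mul (f g : Lp ℝ 2 μ) : Integrable (fun x => f x * g x) μ := by
  have := L2.integrable_inner (𝕜 := ℝ) g f
  simpa only [RCLike.inner_apply, conj_trivial] using this

/-- A nonzero element of `L²` forces `μ ≠ 0`. [folklore] -/
theorem measure_ne_zero_of_ne_zero {ψ : Lp ℝ 2 μ} (hψ : ψ ≠ 0) : μ ≠ 0 := by
  rintro rfl
  exact hψ (Lp.eq_zero_iff_ae_eq_zero.2 (by simp [Filter.EventuallyEq, MeasureTheory.ae_zero]))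

/-- Strictly positive functions are nonnegative. [folklore] -/
theorem IsStrictlyPositiveFun.nonneg {f : Lp ℝ 2 μ} (hf : IsStrictlyPositiveFun f) : 0 ≤ f :=
  (Lp.coeFn_nonneg f).1 (hf.mono fun _ hx => hx.le)

/-- On a nonzero measure space a strictly positive function is positive. [folklore] -/
theorem IsStrictlyPositiveFun.isPositiveFun (hμ : μ ≠ 0) {f : Lp ℝ 2 μ}
    (hf : IsStrictlyPositiveFun f) : IsPositiveFun f := by
  refine ⟨hf.nonneg, fun h0 => hμ ?_⟩
  have h : ∀ᵐ x ∂μ, False := by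
    filter_upwards [hf, Lp.eq_zero_iff_ae_eq_zero.1 h0] with x hx h0x
    rw [h0x, Pi.zero_apply] at hx
    exact lt_irrefl 0 hx
  exact MeasureTheory.ae_eq_bot.1 (Filter.eventually_false_iff_eq_bot.1 h)

/-- A strictly positive `L²` function is scaled to a strictly positive one by a positive constant.
[folklore] -/
theorem IsStrictlyPositiveFun.smul {f : Lp ℝ 2 μ} (hf : IsStrictlyPositiveFun f) {c : ℝ}
    (hc : 0 < c) : IsStrictlyPositiveFun (c • f) := by
  unfold IsStrictlyPositiveFun
  filter_upwards [hf, Lp.coeFn_smul c f] with x hx hsm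
  rw [hsm, Pi.smul_apply, smul_eq_mul]
  exact mul_pos hc hx

/-- `(u, q) > 0` for `u` positive and `q` strictly positive (Reed–Simon IV, p. 201: "`q` is
strictly positive iff `(f, q) > 0` for all positive `f`", the easy direction).
[cite: ReedSimonIV1978, §XIII.12 remark after the Definition (p. 201)] -/
theorem inner_pos {u q : Lp ℝ 2 μ} (hu : IsPositiveFun u) (hq : IsStrictlyPositiveFun q) :
    0 < ⟪u, q⟫ := by
  rw [inner_eq_integral]
  have hu0 := (Lp.coeFn_nonneg u).2 hu.1
  have hnn : 0 ≤ᵐ[μ] fun x => u x * q x := by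
    filter_upwards [hu0, hq] with x hx hy using mul_nonneg hx hy.le
  rcases (integral_nonneg_of_ae hnn).eq_or_lt with h | h
  · exfalso
    rw [eq_comm, integral_eq_zero_iff_of_nonneg_ae hnn (integrable_mul u q)] at h
    refine hu.2 (Lp.eq_zero_iff_ae_eq_zero.2 ?_)
    filter_upwards [h, hq] with x hx hqx
    rw [Pi.zero_apply] at hx ⊢
    rcases mul_eq_zero.1 hx with h1 | h1
    · exact h1
    · exact absurd h1 hqx.ne'
  · exact h

/-! ### Positivity improving operators -/

/-- A positivity improving operator maps nonnegative functions to nonnegative functions.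
[cite: ReedSimonIV1978, §XIII.12 Definition (p. 201)] -/
theorem IsPositivityImproving.nonneg {A : Lp ℝ 2 μ →L[ℝ] Lp ℝ 2 μ} (hA : IsPositivityImproving A)
    {f : Lp ℝ 2 μ} (hf : 0 ≤ f) : 0 ≤ A f := by
  by_cases h0 : f = 0
  · simp [h0]
  · exact (hA f ⟨hf, h0⟩).nonneg

/-- Positivity improving ⇒ positivity preserving (on a nonzero measure space)
(Reed–Simon IV, p. 201). [cite: ReedSimonIV1978, §XIII.12 remark after the Definition (p. 201)] -/
theorem IsPositivityImproving.isPositivityPreserving (hμ : μ ≠ 0) {A : Lp ℝ 2 μ →L[ℝ] Lp ℝ 2 μ}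
    (hA : IsPositivityImproving A) : IsPositivityPreserving A :=
  fun f hf => (hA f hf).isPositiveFun hμ

/-- "Every positivity improving map is ergodic" (Reed–Simon IV, p. 201; with `n = 1`).
[cite: ReedSimonIV1978, §XIII.12 remark after the Definition (p. 201)] -/
theorem IsPositivityImproving.isErgodicOp (hμ : μ ≠ 0) {A : Lp ℝ 2 μ →L[ℝ] Lp ℝ 2 μ}
    (hA : IsPositivityImproving A) : IsErgodicOp A :=
  ⟨hA.isPositivityPreserving hμ, fun u v hu hv =>
    ⟨1, one_pos, by rw [pow_one]; exact (inner_pos hu (hA v hv)).ne'⟩⟩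

/-- `|A f| ≤ A |f|` a.e. for a positivity improving `A` (Reed–Simon IV, proof of XIII.43,
`(c) ⇒ (a)`: "since `|ψ| ± ψ ≥ 0` we know that `A(|ψ| ± ψ) ≥ 0` so `|Aψ| ≤ A|ψ|`").
[cite: ReedSimonIV1978, Thm XIII.43 (proof, p. 202)] -/
theorem IsPositivityImproving.abs_apply_le {A : Lp ℝ 2 μ →L[ℝ] Lp ℝ 2 μ}
    (hA : IsPositivityImproving A) (f : Lp ℝ 2 μ) :
    ∀ᵐ x ∂μ, |A f x| ≤ A |f| x := by
  have h1 : 0 ≤ A (|f| + f) := hA.nonneg (neg_le_iff_add_nonneg.1 (neg_le_abs f))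
  have h2 : 0 ≤ A (|f| - f) := hA.nonneg (sub_nonneg.2 (le_abs_self f))
  rw [map_add, ← Lp.coeFn_nonneg] at h1
  rw [map_sub, ← Lp.coeFn_nonneg] at h2
  filter_upwards [h1, h2, Lp.coeFn_add (A |f|) (A f), Lp.coeFn_sub (A |f|) (A f)] with x hx1 hx2
    hxa hxs
  rw [hxa, Pi.add_apply, Pi.zero_apply] at hx1
  rw [hxs, Pi.sub_apply, Pi.zero_apply] at hx2
  exact abs_le.2 ⟨by linarith, by linarith⟩

/-- `(ψ, Aψ) ≤ (|ψ|, A|ψ|)` for a positivity improving `A` (Reed–Simon IV, proof of XIII.43: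
`(|ψ|, A|ψ|) ≥ (|ψ|, |Aψ|) ≥ (ψ, Aψ)`). [cite: ReedSimonIV1978, Thm XIII.43 (proof, p. 202)] -/
theorem IsPositivityImproving.inner_le_inner_abs {A : Lp ℝ 2 μ →L[ℝ] Lp ℝ 2 μ}
    (hA : IsPositivityImproving A) (ψ : Lp ℝ 2 μ) :
    ⟪ψ, A ψ⟫ ≤ ⟪|ψ|, A |ψ|⟫ := by
  rw [inner_eq_integral, inner_eq_integral]
  refine integral_mono_ae (integrable_mul _ _) (integrable_mul _ _) ?_
  filter_upwards [hA.abs_apply_le ψ, Lp.coeFn_abs ψ] with x hx habs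
  rw [habs]
  calc ψ x * A ψ x ≤ |ψ x * A ψ x| := le_abs_self _
    _ = |ψ x| * |A ψ x| := abs_mul _ _
    _ ≤ |ψ x| * A |ψ| x := mul_le_mul_of_nonneg_left hx (abs_nonneg _)

/-- **Variational characterisation of the top of a symmetric operator.** On a real inner product
space, if `A` is bounded and symmetric and `‖A‖‖f‖² ≤ ⟪f, Af⟫`, then `Af = ‖A‖ f` (the quadratic
form `‖A‖‖h‖² − ⟪h, Ah⟫` is nonnegative and vanishes at `f`, so its "gradient" `‖A‖f − Af`
vanishes; this replaces the spectral-projection step `A|ψ| = ‖A‖|ψ|` of Reed–Simon's proof).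
[folklore] -/
theorem apply_eq_norm_smul_of_le_inner {H : Type*} [NormedAddCommGroup H] [InnerProductSpace ℝ H]
    {A : H →L[ℝ] H} (hA : ∀ x y, ⟪A x, y⟫ = ⟪x, A y⟫) {f : H}
    (hf : ‖A‖ * ‖f‖ ^ 2 ≤ ⟪f, A f⟫) : A f = ‖A‖ • f := by
  set a := ‖A‖ with ha
  have hq : ∀ h : H, ⟪h, A h⟫ ≤ a * ‖h‖ ^ 2 := fun h =>
    calc ⟪h, A h⟫ ≤ ‖h‖ * ‖A h‖ := real_inner_le_norm _ _
      _ ≤ ‖h‖ * (a * ‖h‖) := mul_le_mul_of_nonneg_left (A.le_opNorm h) (norm_nonneg _)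
      _ = a * ‖h‖ ^ 2 := by ring
  set g := a • f - A f with hg
  have e3 : ‖g‖ ^ 2 = a * ⟪f, g⟫ - ⟪g, A f⟫ := by
    rw [← real_inner_self_eq_norm_sq]
    conv_lhs => rw [hg]
    rw [inner_sub_right, inner_smul_right, real_inner_comm g f]
  set c := a * ‖g‖ ^ 2 - ⟪g, A g⟫ with hc
  have hc0 : 0 ≤ c := by have := hq g; linarith
  -- the quadratic form along the line `f + t g`
  have key : ∀ t : ℝ, 0 ≤ 2 * t * ‖g‖ ^ 2 + t ^ 2 * c := by
    intro t
    have h1 := hq (f + t • g)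
    have e1 : ‖f + t • g‖ ^ 2 = ‖f‖ ^ 2 + 2 * t * ⟪f, g⟫ + t ^ 2 * ‖g‖ ^ 2 := by
      rw [← real_inner_self_eq_norm_sq, ← real_inner_self_eq_norm_sq, ← real_inner_self_eq_norm_sq]
      simp only [inner_add_left, inner_add_right, inner_smul_left, inner_smul_right, conj_trivial,
        real_inner_comm g f]
      ring
    have e2 : ⟪f + t • g, A (f + t • g)⟫ = ⟪f, A f⟫ + 2 * t * ⟪g, A f⟫ + t ^ 2 * ⟪g, A g⟫ := by
      simp only [map_add, map_smul, inner_add_left, inner_add_right, inner_smul_left,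
        inner_smul_right, conj_trivial, hA f g, real_inner_comm (A f) g]
      ring
    have e4 : 2 * t * ‖g‖ ^ 2 + t ^ 2 * c =
        (a * ‖f + t • g‖ ^ 2 - ⟪f + t • g, A (f + t • g)⟫) - (a * ‖f‖ ^ 2 - ⟪f, A f⟫) := by
      rw [e1, e2, hc]
      linear_combination (2 * t) * e3
    rw [e4]
    linarith
  have hn : ‖g‖ ^ 2 = 0 := by
    have hn0 : 0 ≤ ‖g‖ ^ 2 := sq_nonneg _
    rcases hc0.eq_or_lt with hc' | hc'
    · have h := key (-1)
      rw [← hc'] at h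
      linarith
    · have h := key (-(‖g‖ ^ 2 / c))
      have e : 2 * (-(‖g‖ ^ 2 / c)) * ‖g‖ ^ 2 + (-(‖g‖ ^ 2 / c)) ^ 2 * c =
          -((‖g‖ ^ 2) ^ 2 / c) := by
        field_simp
        ring
      rw [e] at h
      have h' : (‖g‖ ^ 2) ^ 2 / c ≤ 0 := by linarith
      rw [div_le_iff₀ hc', zero_mul] at h'
      nlinarith
  have : g = 0 := by
    rw [← norm_eq_zero]; exact pow_eq_zero_iff two_ne_zero |>.1 hn
  rw [hg, sub_eq_zero] at this
  exact this.symm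

/-- A nonnegative, nonzero top eigenvector of a positivity improving operator is a.e. strictly
positive: `Ag = ‖A‖g` with `Ag > 0` a.e. (Reed–Simon IV, proof of XIII.43).
[cite: ReedSimonIV1978, Thm XIII.43 (proof, pp. 202–203)] -/
theorem IsPositivityImproving.strictlyPositive_of_eigen {A : Lp ℝ 2 μ →L[ℝ] Lp ℝ 2 μ}
    (hA : IsPositivityImproving A) {g : Lp ℝ 2 μ} (hg0 : 0 ≤ g) (hg1 : g ≠ 0)
    (hg : A g = ‖A‖ • g) : IsStrictlyPositiveFun g := by
  have h := hA g ⟨hg0, hg1⟩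
  rw [hg] at h
  rw [← Lp.coeFn_nonneg] at hg0
  unfold IsStrictlyPositiveFun
  filter_upwards [h, Lp.coeFn_smul ‖A‖ g, hg0] with x hx hsm hx0
  rw [hsm, Pi.smul_apply, smul_eq_mul] at hx
  rw [Pi.zero_apply] at hx0
  rcases hx0.eq_or_lt with h0 | h0
  · rw [← h0, mul_zero] at hx; exact absurd hx (lt_irrefl 0)
  · exact h0

section Main

variable {A : Lp ℝ 2 μ →L[ℝ] Lp ℝ 2 μ}

/-- For a self-adjoint positivity improving `A`, the absolute value of a top eigenvector is again
a top eigenvector: `Aψ = ‖A‖ψ ⇒ A|ψ| = ‖A‖|ψ|` (Reed–Simon IV, proof of XIII.43: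
`(|ψ|, A|ψ|) ≥ (ψ, Aψ) = ‖A‖‖ψ‖²`, "as a result `A|ψ| = ‖A‖|ψ|`").
[cite: ReedSimonIV1978, Thm XIII.43 (proof, pp. 202–203)] -/
theorem IsPositivityImproving.abs_eigen (hA : IsSelfAdjoint A) (hImp : IsPositivityImproving A)
    {ψ : Lp ℝ 2 μ} (hψ : A ψ = ‖A‖ • ψ) : A |ψ| = ‖A‖ • |ψ| := by
  refine apply_eq_norm_smul_of_le_inner (fun x y => hA.isSymmetric x y) ?_
  calc ‖A‖ * ‖|ψ|‖ ^ 2 = ‖A‖ * ‖ψ‖ ^ 2 := by rw [norm_abs_eq_norm]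
    _ = ⟪ψ, A ψ⟫ := by rw [hψ, inner_smul_right, real_inner_self_eq_norm_sq]
    _ ≤ ⟪|ψ|, A |ψ|⟫ := hImp.inner_le_inner_abs ψ

/-- **Sign dichotomy** (Reed–Simon IV, proof of XIII.43: "every real eigenvector with eigenvalue
`‖A‖` is a.e. strictly positive or a.e. strictly negative"): for a self-adjoint positivity
improving `A` and `Aψ = ‖A‖ψ`, either `ψ = |ψ|` or `ψ = −|ψ|`.
[cite: ReedSimonIV1978, Thm XIII.43 (proof, p. 203)] -/
theorem IsPositivityImproving.eq_abs_or_eq_neg_abs (hA : IsSelfAdjoint A)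
    (hImp : IsPositivityImproving A) {ψ : Lp ℝ 2 μ} (hψ : A ψ = ‖A‖ • ψ) :
    ψ = |ψ| ∨ ψ = -|ψ| := by
  have habs := hImp.abs_eigen hA hψ
  by_cases h0 : |ψ| - ψ = 0
  · exact Or.inl (sub_eq_zero.1 h0).symm
  · right
    have hg : A (|ψ| - ψ) = ‖A‖ • (|ψ| - ψ) := by rw [map_sub, habs, hψ, smul_sub]
    have hpos := hImp.strictlyPositive_of_eigen (sub_nonneg.2 (le_abs_self ψ)) h0 hg
    refine Lp.ext_iff.2 ?_
    filter_upwards [hpos, Lp.coeFn_sub |ψ| ψ, Lp.coeFn_abs ψ, Lp.coeFn_neg |ψ|] with x hx hsub habx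
      hneg
    rw [hsub, Pi.sub_apply, habx] at hx
    rw [hneg, Pi.neg_apply, habx]
    have : ψ x < 0 := by
      by_contra hcon
      rw [not_lt] at hcon
      rw [abs_of_nonneg hcon] at hx
      linarith
    rw [abs_of_neg this, neg_neg]

/-- **Reed–Simon IV, Theorem XIII.43, `positivity improving ⇒ (a)`, absolute-value form.** Let `A`
be a bounded self-adjoint, positivity improving operator on the real `L²(M, dμ)` and let `ψ ≠ 0`
be an eigenvector for the eigenvalue `‖A‖`. Then `|ψ|` is an a.e. strictly positive eigenvector
for `‖A‖`, `ψ = |ψ|` or `ψ = −|ψ|`, and every eigenvector `η` for `‖A‖` is the multiple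
`(⟪|ψ|, η⟫/‖ψ‖²) |ψ|` — i.e. `‖A‖` is a simple eigenvalue with a strictly positive eigenvector
(the book's hypotheses "`A ≥ 0`, positivity preserving, ergodic/irreducible" are implied by, resp.
weakened to, self-adjointness and positivity improvement; Theorem XIII.44 (e) ⇒ (a) is this
statement for `A = e^{-tH}`, `‖A‖ = e^{-tE}`).
[cite: ReedSimonIV1978, Thm XIII.43 and Thm XIII.44] -/
theorem IsPositivityImproving.top_eigenvector_abs (hA : IsSelfAdjoint A)
    (hImp : IsPositivityImproving A) {ψ : Lp ℝ 2 μ} (hψ0 : ψ ≠ 0) (hψ : A ψ = ‖A‖ • ψ) :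
    IsStrictlyPositiveFun |ψ| ∧ A |ψ| = ‖A‖ • |ψ| ∧ (ψ = |ψ| ∨ ψ = -|ψ|) ∧
      ∀ η : Lp ℝ 2 μ, A η = ‖A‖ • η → η = (⟪|ψ|, η⟫ / ‖ψ‖ ^ 2) • |ψ| := by
  have habs := hImp.abs_eigen hA hψ
  have hne : |ψ| ≠ 0 := by
    rw [← norm_ne_zero_iff, norm_abs_eq_norm, norm_ne_zero_iff]; exact hψ0
  have hpos : IsStrictlyPositiveFun |ψ| := hImp.strictlyPositive_of_eigen (abs_nonneg ψ) hne habs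
  refine ⟨hpos, habs, hImp.eq_abs_or_eq_neg_abs hA hψ, fun η hη => ?_⟩
  set c := ⟪|ψ|, η⟫ / ‖ψ‖ ^ 2 with hc
  set ζ := η - c • |ψ| with hζ
  have hnorm : ‖ψ‖ ^ 2 ≠ 0 := pow_ne_zero 2 (norm_ne_zero_iff.2 hψ0)
  have hζeig : A ζ = ‖A‖ • ζ := by
    rw [hζ, map_sub, map_smul, hη, habs, smul_sub, smul_comm]
  have horth : ⟪|ψ|, ζ⟫ = 0 := by
    rw [hζ, inner_sub_right, inner_smul_right, real_inner_self_eq_norm_sq, norm_abs_eq_norm, hc,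
      div_mul_cancel₀ _ hnorm, sub_self]
  suffices hζ0 : ζ = 0 by
    rw [hζ, sub_eq_zero] at hζ0; exact hζ0
  by_contra hζ0
  have hζne : |ζ| ≠ 0 := by
    rw [← norm_ne_zero_iff, norm_abs_eq_norm, norm_ne_zero_iff]; exact hζ0
  have hζpos : IsStrictlyPositiveFun |ζ| :=
    hImp.strictlyPositive_of_eigen (abs_nonneg ζ) hζne (hImp.abs_eigen hA hζeig)
  have hip : 0 < ⟪|ψ|, |ζ|⟫ := inner_pos ⟨abs_nonneg ψ, hne⟩ hζpos
  rcases hImp.eq_abs_or_eq_neg_abs hA hζeig with h | h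
  · rw [h] at horth
    linarith
  · rw [h, inner_neg_right] at horth
    linarith

/-- **Reed–Simon IV, Theorems XIII.43 / XIII.44, conclusion (a): the top eigenvalue of a
self-adjoint positivity improving operator is simple with a strictly positive eigenvector.** If
`A` is bounded, self-adjoint and positivity improving on the real `L²(M, dμ)` and `‖A‖` is an
eigenvalue, then there is a unit vector `φ`, a.e. strictly positive, with `Aφ = ‖A‖φ`, such that
every eigenvector `η` for `‖A‖` equals `⟪φ, η⟫ φ` (the `‖A‖`-eigenspace is `ℝφ`). For the ground
state of a self-adjoint `H` bounded below (XIII.44) apply this to `A = e^{-tH}` (`‖A‖ = e^{-tE}`)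
or to the resolvent `A = (H − λ)⁻¹`, `λ < E` (`‖A‖ = (E − λ)⁻¹`), whose `‖A‖`-eigenvectors are the
eigenvectors of `H` at `E = inf σ(H)`. [cite: ReedSimonIV1978, Thm XIII.43 and Thm XIII.44] -/
theorem IsPositivityImproving.simple_top_eigenvalue (hA : IsSelfAdjoint A)
    (hImp : IsPositivityImproving A) (hE : ∃ ψ : Lp ℝ 2 μ, ψ ≠ 0 ∧ A ψ = ‖A‖ • ψ) :
    ∃ φ : Lp ℝ 2 μ, ‖φ‖ = 1 ∧ IsStrictlyPositiveFun φ ∧ A φ = ‖A‖ • φ ∧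
      ∀ η : Lp ℝ 2 μ, A η = ‖A‖ • η → η = ⟪φ, η⟫ • φ := by
  obtain ⟨ψ, hψ0, hψ⟩ := hE
  obtain ⟨hpos, habs, -, hspan⟩ := hImp.top_eigenvector_abs hA hψ0 hψ
  have hn : ‖ψ‖ ≠ 0 := norm_ne_zero_iff.2 hψ0
  have hn' : 0 < ‖ψ‖ := norm_pos_iff.2 hψ0
  refine ⟨‖ψ‖⁻¹ • |ψ|, ?_, hpos.smul (inv_pos.2 hn'), ?_, fun η hη => ?_⟩
  · rw [norm_smul, norm_inv, norm_norm, norm_abs_eq_norm, inv_mul_cancel₀ hn]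
  · rw [map_smul, habs, smul_comm]
  · conv_lhs => rw [hspan η hη]
    rw [inner_smul_left, conj_trivial, smul_smul]
    congr 1
    field_simp

end Main

end Literature.Analysis.OperatorTheory
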